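import Mathlib

/-!
# NE7EJTorusFourier — row NE7 (node U5), candidate route HOM, variant H1L-EJ, item EJ-1b′ (T1)–(T3′): the lattice FOURIER TOOLKIT behind lens 1's
# (A2)–(A3) on the even torus `(ℤ∕2N)²` — plane waves, Parseval, inversion, the plaquette-Laplacian symbol `ω(p) = 4Σ_μ sin²(θ_μ∕2)`, the
# L = 2 block corners with the COARSE PLANCHEREL STEP `Σ_P ‖Σ_p a_p χ_p(ιP)‖² = N²·Σ_c ‖Σ_{p ≡ c (N)} a_p‖²`, the tent average and `g(K)` in
# Fourier variables

Lineage `b2b-balaban-t4-ne7-p2` (CRUX PROVER NE7 #2 = C-HOM°'s kernel hand), generation 81; file 123.  Mathlib-only imports (so that it lands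
ahead of the olean backlog; its consumers 124 `NE7EJTorusAlias` ∕ 125 `NE7EJFlatBloch` close lens 1's flat sharp master inequality on every even
torus by combining it with files 117–118 and 122).

SOURCE (lens 1 = `t4-ne7-idea-1` gen 67, `DEFECT-VS-HESSIAN-NOTE.md` 9e7cf2b6f8adbc99 §1 (A2)–(A3)): «EF^flat ≥ φ(Hess^flat) on phys ⇔ 4A†A ≤ g(−Δ_plaq)
on mean-zero plaquette fields … (−Δ_plaq = CC†, symbol ω(p) = 4Σ_μ sin²(p_μ∕2)).  (A3) A couples p only to its aliases p + πn, n ∈ {0,1}²; in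
each alias block 4A†A = |t⟩⟨t| is RANK ONE …».  THIS FILE supplies the [folklore] Fourier analysis those two sentences use, on `X = ℤ∕M × ℤ∕M`
with Mathlib's `ZMod.stdAddChar`:
* §1 plane waves `chi p x = e(p₁x₁∕M)e(p₂x₂∕M)`: `chi_add ∕ chi_conj ∕ norm_chi`, **`sum_chi`** (orthogonality), `fhat` (Fourier coefficients),
  **`parseval`** ∕ `parseval_norm`, `sum_chi_mul_conj`, **`inversion`**, **`fhat_shift`**.
* §2 the plaquette Laplacian `lapP` (`= CCᵀ` on 2-forms, d = 2), its symbol `omegaC`, **`fhat_lapP`** ∕ `fhat_lapP_iter`, the angle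
  `ang j = 2πj.val∕M`, `stdAddChar_eq_exp`, **`omegaC_eq`** (`ω(p) = 4sin²(θ(p₁)∕2) + 4sin²(θ(p₂)∕2)`, real).
* §3 (M = 2N) the block corners `corner P = (2P₁, 2P₂)`, the reduction `red : ℤ∕2N → ℤ∕N`, **`sum_stdAddChar_dbl`** ∕ **`sum_chi_corner`** (coarse
  orthogonality `Σ_P χ_r(ιP) = N²·[r ≡ 0 (N)]`), **`sum_corner_normSq`** (the coarse Plancherel step above), the offsets `offB`, the 16-fold tent
  sum `avgS F P = Σ_{u,v∈{0,1}²} F(ιP + u + v)` (= `4·d_cQ` of file 122 at L = 2), `tau16 p = (Σ_u χ_p(u))²`, **`avgS_fourier`**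
  (`M²·avgS F P = Σ_p F̂(p)τ₁₆(p)χ_p(ιP)`), `gK F = F − ½KF + ⅛K²F`, `fhat_gK`, **`form_gK_fourier`** (`M²Σ_x conj F·g(K)F = Σ_p g(ω(p))‖F̂(p)‖²`).

HONEST FRAMING: [folklore] discrete Fourier analysis on a finite torus; no inequality is proved here (that is files 124–125 with 117–118); lens 1's
objects stay hers; nothing of Bałaban's instantiated; d = 2 flat toy level; NOT a letter move (PRICING-NE7 v50); T-50-10 honoured.  NE7 NOT PRINTED ∕
NOT PROVED; spine 0∕9; FIXED FINITE T⁴, rung (B)+1; NOT infinite volume, NOT mass gap, NOT Clay.  HONEST DEPENDENCY: continuum YM on T⁴ ⇐ BetaPertH ∧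
nine spine estimates (0/9 proved); BetaPertH ⇐ (D1) ∧ (D4) ∧ CAP+tail; G-an2-4 gates asym, D1 and NE2/3/4.
-/

noncomputable section

open Finset Complex ZMod

namespace Summit.QuantumFields.BalabanUV.T4Continuum.NE7EJTorusFourier


variable {M : ℕ} [NeZero M]

/-- the torus (copied shape of file 122's `X`). -/
abbrev XX (M : ℕ) := ZMod M × ZMod M

/-- plane waves `χ_p(x) = e(p₁x₁∕M)·e(p₂x₂∕M)`. [folklore] -/
def chi (p x : XX M) : ℂ := stdAddChar (p.1 * x.1) * stdAddChar (p.2 * x.2)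

/-- `chi_comm`: bookkeeping identity for the torus Fourier toolkit. [folklore] -/
theorem chi_comm (p x : XX M) : chi p x = chi x p := by
  unfold chi; rw [mul_comm p.1, mul_comm p.2]

/-- `chi_add`: bookkeeping identity for the torus Fourier toolkit. [folklore] -/
theorem chi_add (p x y : XX M) : chi p (x + y) = chi p x * chi p y := by
  unfold chi
  simp only [Prod.fst_add, Prod.snd_add, mul_add, AddChar.map_add_eq_mul]
  ring

/-- `chi_zero_right`: bookkeeping identity for the torus Fourier toolkit. [folklore] -/
theorem chi_zero_right (p : XX M) : chi p 0 = 1 := by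
  unfold chi; simp

/-- `stdAddChar_conj`: bookkeeping identity for the torus Fourier toolkit. [folklore] -/
theorem stdAddChar_conj (j : ZMod M) : starRingEnd ℂ (stdAddChar j) = stdAddChar (-j) := by
  rw [stdAddChar_apply, stdAddChar_apply, AddChar.map_neg_eq_inv, Circle.coe_inv_eq_conj]

/-- `chi_conj`: bookkeeping identity for the torus Fourier toolkit. [folklore] -/
theorem chi_conj (p x : XX M) : starRingEnd ℂ (chi p x) = chi p (-x) := by
  unfold chi
  rw [map_mul, stdAddChar_conj, stdAddChar_conj, Prod.fst_neg, Prod.snd_neg, mul_neg, mul_neg]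

/-- `norm_stdAddChar`: bookkeeping identity for the torus Fourier toolkit. [folklore] -/
theorem norm_stdAddChar (j : ZMod M) : ‖(stdAddChar j : ℂ)‖ = 1 := by
  rw [stdAddChar_apply, Circle.norm_coe]

/-- `norm_chi`: bookkeeping identity for the torus Fourier toolkit. [folklore] -/
theorem norm_chi (p x : XX M) : ‖chi p x‖ = 1 := by
  unfold chi; rw [norm_mul, norm_stdAddChar, norm_stdAddChar, mul_one]

/-- `chi_mul_conj`: bookkeeping identity for the torus Fourier toolkit. [folklore] -/
theorem chi_mul_conj (p x : XX M) : chi p x * starRingEnd ℂ (chi p x) = 1 := by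
  rw [Complex.mul_conj, Complex.normSq_eq_norm_sq, norm_chi]; norm_num

/-- one-dimensional orthogonality. [folklore] -/
theorem sum_stdAddChar_mul (t : ZMod M) : ∑ i : ZMod M, (stdAddChar (t * i) : ℂ) = if t = 0 then (M : ℂ) else 0 := by
  split_ifs with h
  · simp [h]
  · exact AddChar.sum_eq_zero_of_ne_one (isPrimitive_stdAddChar M h)

/-- **orthogonality of plane waves**: `Σ_x χ_p(x) = M²·[p = 0]`. [folklore] -/
theorem sum_chi (p : XX M) : ∑ x : XX M, chi p x = if p = 0 then ((M : ℂ) ^ 2) else 0 := by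
  unfold chi
  rw [Fintype.sum_prod_type]
  simp_rw [← mul_sum, ← sum_mul]
  rw [sum_stdAddChar_mul, sum_stdAddChar_mul]
  obtain ⟨p₁, p₂⟩ := p
  by_cases h1 : p₁ = 0 <;> by_cases h2 : p₂ = 0 <;> simp [h1, h2, sq, Prod.ext_iff]

/-- Fourier coefficients `F̂(p) := Σ_x conj(χ_p(x))·F(x)`. [folklore] -/
def fhat (F : XX M → ℂ) (p : XX M) : ℂ := ∑ x, starRingEnd ℂ (chi p x) * F x

/-- **Parseval, sesquilinear**: `Σ_p conj(F̂ p)·Ĝ p = M²·Σ_x conj(F x)·G x`. [folklore] -/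
theorem parseval (F G : XX M → ℂ) :
    ∑ p, starRingEnd ℂ (fhat F p) * fhat G p = (M : ℂ) ^ 2 * ∑ x, starRingEnd ℂ (F x) * G x := by
  unfold fhat
  simp_rw [map_sum, map_mul, Complex.conj_conj, sum_mul, mul_sum]
  -- Σ_p Σ_x Σ_y χ_p(x) conj(F x) conj(χ_p(y)) G y
  have key : ∀ x y : XX M, ∑ p : XX M, chi p x * starRingEnd ℂ (F x) * (starRingEnd ℂ (chi p y) * G y)
      = (if x = y then (M : ℂ) ^ 2 else 0) * (starRingEnd ℂ (F x) * G y) := by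
    intro x y
    have e : ∀ p : XX M, chi p x * starRingEnd ℂ (F x) * (starRingEnd ℂ (chi p y) * G y)
        = chi (x - y) p * (starRingEnd ℂ (F x) * G y) := fun p => by
      rw [chi_conj, chi_comm (x - y) p, sub_eq_add_neg, chi_add]; ring
    simp_rw [e, ← sum_mul]
    rw [sum_chi]
    simp only [sub_eq_zero]
  rw [sum_comm]
  refine sum_congr rfl fun x _ => ?_
  rw [sum_comm]
  simp_rw [key, ite_mul, zero_mul]
  rw [sum_ite_eq, if_pos (mem_univ _)]

/-- **Parseval**: `Σ_p ‖F̂ p‖² = M²·Σ_x ‖F x‖²`. [folklore] -/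
theorem parseval_norm (F : XX M → ℂ) : ∑ p, ‖fhat F p‖ ^ 2 = (M : ℝ) ^ 2 * ∑ x, ‖F x‖ ^ 2 := by
  have h := parseval F F
  simp_rw [Complex.conj_mul', ← Complex.ofReal_pow] at h
  rw [← Complex.ofReal_sum, ← Complex.ofReal_sum] at h
  exact_mod_cast h

/-- the kernel identity behind Parseval and inversion: `Σ_p χ_p(x)·conj χ_p(y) = M²·[x = y]`. [folklore] -/
theorem sum_chi_mul_conj (x y : XX M) : ∑ p : XX M, chi p x * starRingEnd ℂ (chi p y) = if x = y then ((M : ℂ) ^ 2) else 0 := by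
  have e : ∀ p : XX M, chi p x * starRingEnd ℂ (chi p y) = chi (x - y) p := fun p => by
    rw [chi_conj, chi_comm (x - y) p, sub_eq_add_neg, chi_add]
  simp_rw [e]
  rw [sum_chi]; simp only [sub_eq_zero]

/-- **Fourier inversion**: `F(x) = M^{−2}·Σ_p χ_p(x)·F̂(p)`. [folklore] -/
theorem inversion (F : XX M → ℂ) (x : XX M) : ∑ p, chi p x * fhat F p = (M : ℂ) ^ 2 * F x := by
  unfold fhat
  simp_rw [mul_sum]
  rw [sum_comm]
  have e : ∀ y : XX M, ∑ p : XX M, chi p x * (starRingEnd ℂ (chi p y) * F y) = (if x = y then ((M : ℂ) ^ 2) else 0) * F y :=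
    fun y => by simp_rw [← mul_assoc, ← sum_mul]; rw [sum_chi_mul_conj]
  simp_rw [e, ite_mul, zero_mul]
  rw [sum_ite_eq, if_pos (mem_univ _)]

/-- translation multiplies the Fourier coefficient by the character: `(F(· + v))^(p) = χ_p(v)·F̂(p)`. [folklore] -/
theorem fhat_shift (F : XX M → ℂ) (v p : XX M) : fhat (fun x => F (x + v)) p = chi p v * fhat F p := by
  unfold fhat
  rw [Fintype.sum_equiv (Equiv.addRight v) (fun x => starRingEnd ℂ (chi p x) * F (x + v))
      (fun y => starRingEnd ℂ (chi p (y - v)) * F y) (fun x => by simp)]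
  rw [mul_sum]
  refine sum_congr rfl fun y _ => ?_
  rw [sub_eq_add_neg, chi_add, map_mul, chi_conj p (-v), neg_neg]; ring

/-! ### The plaquette Laplacian `−Δ = CCᵀ` and its symbol -/

/-- unit vectors of the torus. [folklore] -/
def e0 : XX M := (1, 0)
/-- unit vectors of the torus. [folklore] -/
def e1 : XX M := (0, 1)

/-- the plaquette Laplacian `(KF)(x) = 4F(x) − F(x+e₀) − F(x−e₀) − F(x+e₁) − F(x−e₁)` (`= CCᵀ` on 2-forms in d = 2). [folklore] -/
def lapP (F : XX M → ℂ) (x : XX M) : ℂ := 4 * F x - F (x + e0) - F (x + -e0) - F (x + e1) - F (x + -e1)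

/-- the symbol `ω(p) = 4 − χ_p(e₀) − χ_p(−e₀) − χ_p(e₁) − χ_p(−e₁)`. [folklore] -/
def omegaC (p : XX M) : ℂ := 4 - chi p e0 - chi p (-e0) - chi p e1 - chi p (-e1)

/-- **the Laplacian is a Fourier multiplier**: `(KF)^(p) = ω(p)·F̂(p)`. [folklore] -/
theorem fhat_lapP (F : XX M → ℂ) (p : XX M) : fhat (lapP F) p = omegaC p * fhat F p := by
  have hlin : fhat (lapP F) p = 4 * fhat F p - fhat (fun x => F (x + e0)) p - fhat (fun x => F (x + -e0)) p
      - fhat (fun x => F (x + e1)) p - fhat (fun x => F (x + -e1)) p := by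
    unfold fhat lapP
    simp only [mul_sub, sum_sub_distrib, mul_sum]
    congr 1; congr 1; congr 1; congr 1
    exact sum_congr rfl fun x _ => by ring
  rw [hlin, fhat_shift, fhat_shift, fhat_shift, fhat_shift, omegaC]; ring

/-- iterating: `(K^k F)^(p) = ω(p)^k·F̂(p)`. [folklore] -/
theorem fhat_lapP_iter (F : XX M → ℂ) (p : XX M) : ∀ k : ℕ, fhat (lapP^[k] F) p = omegaC p ^ k * fhat F p
  | 0 => by simp
  | k + 1 => by rw [Function.iterate_succ_apply', fhat_lapP, fhat_lapP_iter F p k, pow_succ]; ring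

/-- the angle `θ(j) = 2πj∕M` of a residue (through `ZMod.val`). [folklore] -/
def ang (j : ZMod M) : ℝ := 2 * Real.pi * (j.val : ℝ) / M

/-- `stdAddChar j = exp(iθ(j))`. [folklore] -/
theorem stdAddChar_eq_exp (j : ZMod M) : (stdAddChar j : ℂ) = Complex.exp (ang j * Complex.I) := by
  rw [stdAddChar_apply, toCircle_apply, ang]
  congr 1; push_cast; ring

/-- `χ_p(e₀) = exp(iθ(p₁))`, `χ_p(e₁) = exp(iθ(p₂))`. [folklore] -/
theorem chi_e0 (p : XX M) : chi p e0 = Complex.exp (ang p.1 * Complex.I) := by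
  unfold chi e0; simp [stdAddChar_eq_exp]

/-- `χ_p(e₁) = exp(iθ(p₂))`. [folklore] -/
theorem chi_e1 (p : XX M) : chi p e1 = Complex.exp (ang p.2 * Complex.I) := by
  unfold chi e1; simp [stdAddChar_eq_exp]

/-- `exp(iθ) + conj exp(iθ) = 2cos θ`. [folklore] -/
theorem exp_add_conj (θ : ℝ) : Complex.exp (θ * Complex.I) + starRingEnd ℂ (Complex.exp (θ * Complex.I)) = (2 * Real.cos θ : ℝ) := by
  rw [Complex.add_conj, Complex.exp_ofReal_mul_I_re]

/-- **the symbol is real**: `ω(p) = 4sin²(θ(p₁)∕2) + 4sin²(θ(p₂)∕2)`. [folklore] -/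
theorem omegaC_eq (p : XX M) : omegaC p = ((4 * Real.sin (ang p.1 / 2) ^ 2 + 4 * Real.sin (ang p.2 / 2) ^ 2 : ℝ) : ℂ) := by
  have h0 : chi p e0 + chi p (-e0) = (2 * Real.cos (ang p.1) : ℝ) := by rw [← chi_conj, chi_e0, exp_add_conj]
  have h1 : chi p e1 + chi p (-e1) = (2 * Real.cos (ang p.2) : ℝ) := by rw [← chi_conj, chi_e1, exp_add_conj]
  have : omegaC p = 4 - (chi p e0 + chi p (-e0)) - (chi p e1 + chi p (-e1)) := by unfold omegaC; ring
  rw [this, h0, h1]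
  have half : ∀ θ : ℝ, Real.cos θ = 1 - 2 * Real.sin (θ / 2) ^ 2 := fun θ => by
    have h := Real.cos_two_mul (θ / 2)
    rw [show 2 * (θ / 2) = θ by ring] at h
    have hs := Real.sin_sq_add_cos_sq (θ / 2)
    linarith
  rw [half (ang p.1), half (ang p.2)]; push_cast; ring

/-! ### The L = 2 blocking: corners, the coarse orthogonality, alias fibres -/

section Blocking

variable (N : ℕ) [NeZero N]

/-- `instNeZeroTwoMul`: bookkeeping identity for the torus Fourier toolkit. [folklore] -/
instance instNeZeroTwoMul : NeZero (2 * N) := ⟨by have := NeZero.ne N; omega⟩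

/-- the even embedding `k ↦ 2k : Fin N → ℤ∕2N` (block corners along one axis). [folklore] -/
def dbl (k : Fin N) : ZMod (2 * N) := ((2 * (k : ℕ) : ℕ) : ZMod (2 * N))

/-- the block corner `ι(P) = (2P₁, 2P₂)`. [folklore] -/
def corner (P : Fin N × Fin N) : XX (2 * N) := (dbl N P.1, dbl N P.2)

/-- reduction mod `N`: `ℤ∕2N → ℤ∕N`. [folklore] -/
def red : ZMod (2 * N) →+* ZMod N := ZMod.castHom (Dvd.intro_left 2 rfl) (ZMod N)

/-- `val` is transported by `ZMod.finEquiv`. [folklore] -/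
theorem val_finEquiv' : ∀ (N : ℕ) [NeZero N] (k : Fin N), (ZMod.finEquiv N k).val = k
  | 0, h, _ => absurd rfl (@NeZero.ne ℕ _ 0 h)
  | _ + 1, _, _ => rfl

/-- `ZMod.finEquiv` is the cast `k ↦ (k : ℤ∕N)`. [folklore] -/
theorem finEquiv_apply_eq (k : Fin N) : (ZMod.finEquiv N k : ZMod N) = ((k : ℕ) : ZMod N) := by
  apply ZMod.val_injective
  rw [val_finEquiv', ZMod.val_natCast, Nat.mod_eq_of_lt k.isLt]

/-- reindexing a sum over `Fin N` by residues. [folklore] -/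
theorem sum_fin_eq_sum_zmod (f : ZMod N → ℂ) : ∑ k : Fin N, f ((k : ℕ) : ZMod N) = ∑ j : ZMod N, f j :=
  Fintype.sum_equiv (ZMod.finEquiv N).toEquiv _ _ fun k => by
    simp only [RingEquiv.toEquiv_eq_coe, EquivLike.coe_coe]
    rw [finEquiv_apply_eq]

/-- the one-dimensional coarse character sum: `Σ_{k<N} e(r·2k∕2N) = N·[r ≡ 0 mod N]`. [folklore] -/
theorem sum_stdAddChar_dbl (r : ZMod (2 * N)) :
    ∑ k : Fin N, (stdAddChar (r * dbl N k) : ℂ) = if red N r = 0 then (N : ℂ) else 0 := by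
  -- pointwise: `e_{2N}(r·2k) = e_N(red r · k)`
  have hpt : ∀ k : Fin N, (stdAddChar (r * dbl N k) : ℂ) = stdAddChar (red N r * ((k : ℕ) : ZMod N)) := by
    intro k
    have hr : r = ((r.val : ℕ) : ZMod (2 * N)) := (ZMod.natCast_zmod_val r).symm
    rw [dbl, hr, ← Nat.cast_mul, stdAddChar_apply, toCircle_natCast, stdAddChar_apply]
    rw [show red N ((r.val : ℕ) : ZMod (2 * N)) * ((k : ℕ) : ZMod N) = ((r.val * k : ℕ) : ZMod N) by
      rw [map_natCast, Nat.cast_mul], toCircle_natCast]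
    congr 1
    have hN : (N : ℂ) ≠ 0 := by exact_mod_cast NeZero.ne N
    push_cast
    field_simp
  simp_rw [hpt]
  rw [sum_fin_eq_sum_zmod N (fun j => (stdAddChar (red N r * j) : ℂ)), sum_stdAddChar_mul]

/-- coordinatewise reduction mod `N` of a fine momentum. [folklore] -/
def red2 (p : XX (2 * N)) : XX N := (red N p.1, red N p.2)

omit [NeZero N] in
/-- `red2` is additive. [folklore] -/
theorem red2_sub (p q : XX (2 * N)) : red2 N (p - q) = red2 N p - red2 N q := by
  unfold red2; simp [map_sub]

/-- **coarse orthogonality**: `Σ_P χ_r(ι P) = N²·[r ≡ 0 mod N]` over the block corners. [folklore] -/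
theorem sum_chi_corner (r : XX (2 * N)) : ∑ P : Fin N × Fin N, chi r (corner N P) = if red2 N r = 0 then ((N : ℂ) ^ 2) else 0 := by
  unfold chi corner
  simp only
  rw [Fintype.sum_prod_type]
  simp_rw [← mul_sum, ← sum_mul]
  rw [sum_stdAddChar_dbl, sum_stdAddChar_dbl]
  unfold red2
  by_cases h1 : red N r.1 = 0 <;> by_cases h2 : red N r.2 = 0 <;> simp [h1, h2, sq, Prod.ext_iff]

/-- `χ_p(z)·conj χ_q(z) = χ_{p−q}(z)`. [folklore] -/
theorem chi_mul_conj_eq (p q z : XX (2 * N)) : chi p z * starRingEnd ℂ (chi q z) = chi (p - q) z := by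
  rw [chi_comm p z, chi_comm q z, chi_conj, ← chi_add, ← sub_eq_add_neg, chi_comm]

/-- **the coarse Plancherel step**: `Σ_P ‖Σ_p a_p χ_p(ιP)‖² = N²·Σ_c ‖Σ_{p : red p = c} a_p‖²` — the corner sum sees a fine momentum only
through its residue mod `N` (the alias class). [folklore] -/
theorem sum_corner_normSq (a : XX (2 * N) → ℂ) :
    ∑ P : Fin N × Fin N, ‖∑ p, a p * chi p (corner N P)‖ ^ 2
      = (N : ℝ) ^ 2 * ∑ c : XX N, ‖∑ p ∈ univ.filter (fun p => red2 N p = c), a p‖ ^ 2 := by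
  -- complex form first
  have hC : ∀ P : Fin N × Fin N, ((‖∑ p, a p * chi p (corner N P)‖ ^ 2 : ℝ) : ℂ)
      = ∑ p, ∑ q, a p * starRingEnd ℂ (a q) * (chi p (corner N P) * starRingEnd ℂ (chi q (corner N P))) := by
    intro P
    push_cast
    rw [← Complex.mul_conj', map_sum, sum_mul_sum]
    refine sum_congr rfl fun p _ => sum_congr rfl fun q _ => ?_
    rw [map_mul]; ring
  have hD : ∀ c : XX N, ((‖∑ p ∈ univ.filter (fun p => red2 N p = c), a p‖ ^ 2 : ℝ) : ℂ)
      = ∑ p ∈ univ.filter (fun p => red2 N p = c), ∑ q ∈ univ.filter (fun q => red2 N q = c), a p * starRingEnd ℂ (a q) := by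
    intro c
    push_cast
    rw [← Complex.mul_conj', map_sum, sum_mul_sum]
  apply Complex.ofReal_injective
  rw [Complex.ofReal_sum, Complex.ofReal_mul, Complex.ofReal_sum]
  simp_rw [hC, hD]
  push_cast
  rw [sum_comm]
  simp_rw [chi_mul_conj_eq]
  -- Σ_p Σ_P Σ_q → Σ_p Σ_q (a p conj a q) N²·[red p = red q]
  have e1 : ∀ p : XX (2 * N), ∑ P : Fin N × Fin N, ∑ q, a p * starRingEnd ℂ (a q) * chi (p - q) (corner N P)
      = ∑ q, a p * starRingEnd ℂ (a q) * (if red2 N p = red2 N q then ((N : ℂ) ^ 2) else 0) := by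
    intro p
    rw [sum_comm]
    refine sum_congr rfl fun q _ => ?_
    rw [← mul_sum, sum_chi_corner]
    simp only [red2_sub, sub_eq_zero]
  simp_rw [e1]
  -- regroup by fibres
  rw [← sum_fiberwise univ (red2 N) (fun p => ∑ q, a p * starRingEnd ℂ (a q) * if red2 N p = red2 N q then ((N : ℂ) ^ 2) else 0)]
  rw [mul_sum]
  refine sum_congr rfl fun c _ => ?_
  rw [mul_sum]
  refine sum_congr rfl fun p hp => ?_
  rw [(mem_filter.mp hp).2, mul_sum, sum_filter]
  refine sum_congr rfl fun q _ => ?_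
  by_cases h : red2 N q = c
  · rw [if_pos h, if_pos h.symm]; ring
  · rw [if_neg h, if_neg (Ne.symm h)]; ring

/-! ### The tent average in Fourier variables -/

/-- the offsets `{0,1}²`. [folklore] -/
def offB (n : Bool × Bool) : XX (2 * N) := ((if n.1 then 1 else 0), (if n.2 then 1 else 0))

/-- the 16-fold tent sum `Σ_{u,v ∈ {0,1}²} F(ι P + u + v)` (= `4·d_cQ` of file 122 at L = 2). [folklore] -/
def avgS (F : XX (2 * N) → ℂ) (P : Fin N × Fin N) : ℂ := ∑ u : Bool × Bool, ∑ v : Bool × Bool, F (corner N P + offB N u + offB N v)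

/-- the amplitude `τ₁₆(p) := (Σ_{u ∈ {0,1}²} χ_p(u))²`. [folklore] -/
def tau16 (p : XX (2 * N)) : ℂ := (∑ u : Bool × Bool, chi p (offB N u)) ^ 2

/-- **the average in Fourier variables**: `M²·avgS F P = Σ_p F̂(p)·χ_p(ιP)·τ₁₆(p)`. [folklore] -/
theorem avgS_fourier (F : XX (2 * N) → ℂ) (P : Fin N × Fin N) :
    ((2 * N : ℕ) : ℂ) ^ 2 * avgS N F P = ∑ p, fhat F p * tau16 N p * chi p (corner N P) := by
  have inv_point : ∀ z : XX (2 * N), ((2 * N : ℕ) : ℂ) ^ 2 * F z = ∑ p, chi p z * fhat F p := fun z => (inversion F z).symm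
  unfold avgS tau16
  simp only [mul_sum, inv_point]
  simp_rw [Finset.sum_comm (s := (univ : Finset (Bool × Bool))) (t := (univ : Finset (XX (2 * N))))]
  refine sum_congr rfl fun p _ => ?_
  simp only [sq, mul_sum, sum_mul]
  refine sum_congr rfl fun u _ => sum_congr rfl fun v _ => ?_
  rw [chi_add, chi_add]; ring

/-! ### The quadratic form of `g(K) = 1 − ½K + ⅛K²` in Fourier variables -/

/-- `g(K)F := F − ½·KF + ⅛·K(KF)`. [folklore] -/
def gK (F : XX (2 * N) → ℂ) : XX (2 * N) → ℂ := fun x => F x - (1 / 2 : ℂ) * lapP F x + (1 / 8 : ℂ) * lapP (lapP F) x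

/-- `(g(K)F)^(p) = g(ω(p))·F̂(p)`. [folklore] -/
theorem fhat_gK (F : XX (2 * N) → ℂ) (p : XX (2 * N)) :
    fhat (gK N F) p = (1 - (1 / 2 : ℂ) * omegaC p + (1 / 8 : ℂ) * omegaC p ^ 2) * fhat F p := by
  have h2 : fhat (lapP (lapP F)) p = omegaC p ^ 2 * fhat F p := by rw [fhat_lapP, fhat_lapP]; ring
  have hlin : fhat (gK N F) p = fhat F p - (1 / 2 : ℂ) * fhat (lapP F) p + (1 / 8 : ℂ) * fhat (lapP (lapP F)) p := by
    unfold fhat gK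
    simp only [mul_add, mul_sub, sum_add_distrib, sum_sub_distrib, mul_sum]
    congr 1; congr 1
    · exact sum_congr rfl fun x _ => by ring
    · exact sum_congr rfl fun x _ => by ring
  rw [hlin, fhat_lapP, h2]; ring

/-- **Parseval for `g(K)`**: `M²·Σ_x conj(F x)·(g(K)F)(x) = Σ_p g(ω(p))·‖F̂(p)‖²`. [folklore] -/
theorem form_gK_fourier (F : XX (2 * N) → ℂ) :
    ((2 * N : ℕ) : ℂ) ^ 2 * ∑ x, starRingEnd ℂ (F x) * gK N F x
      = ∑ p, (1 - (1 / 2 : ℂ) * omegaC p + (1 / 8 : ℂ) * omegaC p ^ 2) * ((‖fhat F p‖ ^ 2 : ℝ) : ℂ) := by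
  rw [← parseval]
  refine sum_congr rfl fun p _ => ?_
  rw [fhat_gK]; push_cast; rw [← Complex.conj_mul']; ring

end Blocking

end Summit.QuantumFields.BalabanUV.T4Continuum.NE7EJTorusFourier

end

-- Build-lane re-trigger (lineage t4-ne7-p2, gen 85, 2026-08-24): comment-only re-land of the tree bytes 0319c0671533e21f (v1 p371226,
-- committed after v2 p371569); every declaration byte-identical.  The module was accepted 2026-08-23T20:22Z inside the no-olean cohort of
-- `ops/buildfix/UNBUILT-ACCEPTED-20260824T1600.txt` (last build event rc 75 NO-HOST, attempt 62) and its importers 124 p371598 ∕ 129 p375236 have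
-- been deferred 76 times on `…NE7EJTorusFourier:no-olean`; cf. ops-buildfix-2's comment-only re-land p372431 of `B7Prop4Flat`.
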